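import Summits.CriticalPhenomena.PercolationContinuityZ3.Theorems.PercNearOneGluingNoHeavyLowerTailSunflowerMultiPetalSpectator
import HarnessLib
import HarnessLib.Audit

/-!
# `NoHeavyLowerTail` (crux stmt-CriticalPhenomena-4575), abstract sunflower cubic, `k` petals: the CONFIGURATION EXPANSION of the antipodal-Gladkov
# slack — the one-coordinate step as an exact identity with its gaps, drop/absorb monotonicity, the COVER lemma and the CONFIGURATION lemma

Support file (seat `prim-l12-p2` gen 31; `--supports stmt-CriticalPhenomena-4575`; companion of `…SunflowerMultiPetalSpectator` (p339016: `kkK`, `kkK_submod`,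
`kkK_comm`, `MSunflower.lab_mono`, `MSunflower.antipodal_sum_nonneg`)).  Everything here is PROVED; no `sorry`, no named facts, no new conjecture.
Memo: run/shared/lean/prim/prim-l12/prim-l12-p2/FINDING-g31-TOPCUBE-STRICTNESS.md §1.1 (the expansion) — these are the Lean tools behind THEOREM T of the memo
('≥ 3 components ⟹ the antipodal-Gladkov inequality on the full cube is strict'), whose combinatorial part (§1.2–1.3 of the memo) is not formalised here.

* `MSunflower.pol W G₁ G₂ := Σ_{S ⊆ W} kkK (lab (G₁ ∪ S)) (lab (G₂ ∪ (W ∖ S)))` — the two-offset polarised antipodal sum of p339016 (`antipodal_sum_nonneg` is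
  `0 ≤ pol W G₁ G₂` for `G₂ ⊆ G₁`); `MSunflower.cgap X Y e` — the submodularity GAP of the configuration `(X, Y; e)`:
  `kk(x⁰,y¹) + kk(x¹,y⁰) − kk(x⁰,y⁰) − kk(x¹,y¹)` for the label chains `x = (lab X ≤ lab (X+e))`, `y = (lab Y ≤ lab (Y+e))`; `cgap_nonneg` (`kkK_submod`).
* **`pol_insert_eq`** (this work): for `e ∉ W`,  `pol (W+e) G₁ G₂ = pol W G₁ G₂ + pol W (G₁+e) (G₂+e) + Σ_{S ⊆ W} cgap (G₁ ∪ S) (G₂ ∪ (W∖S)) e` — Gladkov's induction step as an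
  EXACT identity (the inequality of p339016 is this identity with the gaps dropped); `pol_insert_ge`, `pol_insert_ge_gap` (keep one chosen gap).
* **Drop / absorb monotonicity** for nested offsets `G₂ ⊆ G₁`: `pol_le_pol_insert` (drop a coordinate), `pol_insert_offsets_le` (absorb it into both offsets),
  `pol_absorb_all`, `pol_drop_all`; hence `kkK_leaf_le_pol`: every LEAF `kkK (lab (G₁ ∪ Y)) (lab (G₂ ∪ Y))`, `Y ⊆ W`, is a lower bound for `pol W G₁ G₂`.
* `slackTop := Σ_S kkK (lab S) (lab Sᶜ)` (the antipodal slack of the full cube, `= 2·s(E)` of the memos) and **`slackTop_eq_two_mul_pol`**: `slackTop = 2 · pol (univ ∖ v) {v} ∅`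
  for every `v` (complementation symmetry).
* **COVER LEMMA `two_le_slackTop_of_cover`**: a white set `Y` with a black upper cover `Y + v` forces `slackTop ≥ 2` (i.e. `s(E) ≥ 1`).
* **CONFIGURATION LEMMA `two_le_slackTop_of_cgap_pos`**: two sets `X ∋ v`, `Y ∌ v` and `e ∉ X ∪ Y` with `cgap X Y e ≥ 1` force `slackTop ≥ 2`.  (The positive gaps are exactly
  the patterns {white→black, ·moving}, {white→c, white→c'}, {white→c, c→black}, {c→black, c'→black}, c ≠ c' petals — memo §1.1.)
Together with nonnegativity these say: `s(E) = 0` iff the structure has no cover and no configuration of positive gap ('rigidity'), the starting point of Theorem T.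
-/

namespace Summit.CriticalPhenomena.PercolationContinuityZ3.Theorems.SunflowerPartition

open Finset

/-- `kkK` on (top, bottom) is `1`. [this work] -/
theorem kkK_last_zero (k : ℕ) : kkK k (Fin.last (k + 1)) 0 = 1 := by
  unfold kkK; simp

variable {α : Type*} [DecidableEq α]

namespace MSunflower

variable {k : ℕ} (F : MSunflower k α)

/-! ## The two-offset polarised sum and the gap of a configuration -/

/-- The two-offset polarised antipodal sum `Σ_{S ⊆ W} kkK (lab (G₁ ∪ S)) (lab (G₂ ∪ (W ∖ S)))`. [this work] -/
def pol (W G₁ G₂ : Finset α) : ℤ := ∑ S ∈ W.powerset, kkK k (F.lab (G₁ ∪ S)) (F.lab (G₂ ∪ (W \ S)))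

/-- Nonnegativity for nested offsets (= `antipodal_sum_nonneg` of p339016). [this work] -/
theorem pol_nonneg (W : Finset α) {G₁ G₂ : Finset α} (h : G₂ ⊆ G₁) : 0 ≤ F.pol W G₁ G₂ :=
  F.antipodal_sum_nonneg W G₁ G₂ h

/-- On the empty window the polarised sum is the single kernel value of the offsets. [this work] -/
theorem pol_empty (G₁ G₂ : Finset α) : F.pol ∅ G₁ G₂ = kkK k (F.lab G₁) (F.lab G₂) := by
  unfold pol
  rw [powerset_empty, sum_singleton, union_empty, sdiff_self, bot_eq_empty, union_empty]

/-- The submodularity GAP of the configuration `(X, Y; e)`. [this work] -/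
def cgap (X Y : Finset α) (e : α) : ℤ :=
  kkK k (F.lab X) (F.lab (insert e Y)) + kkK k (F.lab (insert e X)) (F.lab Y)
    - kkK k (F.lab X) (F.lab Y) - kkK k (F.lab (insert e X)) (F.lab (insert e Y))

/-- Gaps are nonnegative (`kkK_submod` on the comparable rectangles `lab X ≤ lab (X+e)`, `lab Y ≤ lab (Y+e)`). [this work] -/
theorem cgap_nonneg (X Y : Finset α) (e : α) : 0 ≤ F.cgap X Y e := by
  unfold cgap
  have h1 := F.lab_mono (subset_insert e X)
  have h2 := F.lab_mono (subset_insert e Y)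
  have := kkK_submod _ _ _ _ h1 h2
  linarith

/-! ## The one-coordinate step as an exact identity -/

/-- **Exact one-coordinate step**: for `e ∉ W`,
`pol (W+e) G₁ G₂ = pol W G₁ G₂ + pol W (G₁+e) (G₂+e) + Σ_{S ⊆ W} cgap (G₁ ∪ S) (G₂ ∪ (W ∖ S)) e`. [this work] -/
theorem pol_insert_eq {W : Finset α} (G₁ G₂ : Finset α) {e : α} (he : e ∉ W) :
    F.pol (insert e W) G₁ G₂
      = F.pol W G₁ G₂ + F.pol W (insert e G₁) (insert e G₂) + ∑ S ∈ W.powerset, F.cgap (G₁ ∪ S) (G₂ ∪ (W \ S)) e := by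
  unfold pol
  rw [sum_powerset_insert he]
  rw [show (∑ S ∈ W.powerset, kkK k (F.lab (G₁ ∪ S)) (F.lab (G₂ ∪ (W \ S))))
        + (∑ S ∈ W.powerset, kkK k (F.lab (insert e G₁ ∪ S)) (F.lab (insert e G₂ ∪ (W \ S))))
        + (∑ S ∈ W.powerset, F.cgap (G₁ ∪ S) (G₂ ∪ (W \ S)) e)
      = ∑ S ∈ W.powerset, (kkK k (F.lab (G₁ ∪ S)) (F.lab (G₂ ∪ (W \ S)))
          + kkK k (F.lab (insert e G₁ ∪ S)) (F.lab (insert e G₂ ∪ (W \ S)))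
          + F.cgap (G₁ ∪ S) (G₂ ∪ (W \ S)) e) from by rw [sum_add_distrib, sum_add_distrib]]
  rw [show (∑ S ∈ W.powerset, kkK k (F.lab (G₁ ∪ S)) (F.lab (G₂ ∪ (insert e W \ S))))
        + (∑ S ∈ W.powerset, kkK k (F.lab (G₁ ∪ insert e S)) (F.lab (G₂ ∪ (insert e W \ insert e S))))
      = ∑ S ∈ W.powerset, (kkK k (F.lab (G₁ ∪ S)) (F.lab (G₂ ∪ (insert e W \ S)))
          + kkK k (F.lab (G₁ ∪ insert e S)) (F.lab (G₂ ∪ (insert e W \ insert e S)))) from by rw [sum_add_distrib]]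
  refine sum_congr rfl fun S hS => ?_
  have hSW : S ⊆ W := mem_powerset.1 hS
  have heS : e ∉ S := fun hx => he (hSW hx)
  rw [Sunflower.union_insert_sdiff heS, Sunflower.insert_sdiff_insert_of_not_mem he, Sunflower.union_insert_eq,
    insert_union, insert_union]
  unfold cgap
  ring

/-- The step as an inequality (drop all gaps): `pol W G₁ G₂ + pol W (G₁+e) (G₂+e) ≤ pol (W+e) G₁ G₂`. [this work] -/
theorem pol_insert_ge {W : Finset α} (G₁ G₂ : Finset α) {e : α} (he : e ∉ W) :
    F.pol W G₁ G₂ + F.pol W (insert e G₁) (insert e G₂) ≤ F.pol (insert e W) G₁ G₂ := by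
  rw [F.pol_insert_eq G₁ G₂ he]
  have : 0 ≤ ∑ S ∈ W.powerset, F.cgap (G₁ ∪ S) (G₂ ∪ (W \ S)) e := sum_nonneg fun S _ => F.cgap_nonneg _ _ _
  linarith

/-- The step keeping ONE chosen gap: for `S ⊆ W`,
`pol W G₁ G₂ + pol W (G₁+e) (G₂+e) + cgap (G₁ ∪ S) (G₂ ∪ (W ∖ S)) e ≤ pol (W+e) G₁ G₂`. [this work] -/
theorem pol_insert_ge_gap {W : Finset α} (G₁ G₂ : Finset α) {e : α} (he : e ∉ W) {S : Finset α} (hS : S ⊆ W) :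
    F.pol W G₁ G₂ + F.pol W (insert e G₁) (insert e G₂) + F.cgap (G₁ ∪ S) (G₂ ∪ (W \ S)) e ≤ F.pol (insert e W) G₁ G₂ := by
  rw [F.pol_insert_eq G₁ G₂ he]
  have : F.cgap (G₁ ∪ S) (G₂ ∪ (W \ S)) e ≤ ∑ S ∈ W.powerset, F.cgap (G₁ ∪ S) (G₂ ∪ (W \ S)) e :=
    single_le_sum (f := fun S => F.cgap (G₁ ∪ S) (G₂ ∪ (W \ S)) e) (fun S _ => F.cgap_nonneg _ _ _) (mem_powerset.2 hS)
  linarith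

/-! ## Drop / absorb monotonicity for nested offsets -/

/-- DROP a coordinate: `pol W G₁ G₂ ≤ pol (W+e) G₁ G₂` (nested offsets). [this work] -/
theorem pol_le_pol_insert {W G₁ G₂ : Finset α} (h : G₂ ⊆ G₁) {e : α} (he : e ∉ W) :
    F.pol W G₁ G₂ ≤ F.pol (insert e W) G₁ G₂ := by
  have h1 := F.pol_insert_ge G₁ G₂ he
  have h2 := F.pol_nonneg W (insert_subset_insert e h)
  linarith

/-- ABSORB a coordinate into both offsets: `pol W (G₁+e) (G₂+e) ≤ pol (W+e) G₁ G₂` (nested offsets). [this work] -/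
theorem pol_insert_offsets_le {W G₁ G₂ : Finset α} (h : G₂ ⊆ G₁) {e : α} (he : e ∉ W) :
    F.pol W (insert e G₁) (insert e G₂) ≤ F.pol (insert e W) G₁ G₂ := by
  have h1 := F.pol_insert_ge G₁ G₂ he
  have h2 := F.pol_nonneg W h
  linarith

/-- Absorb a whole set `D` (disjoint from the window) into both offsets. [this work] -/
theorem pol_absorb_all (D : Finset α) :
    ∀ W G₁ G₂ : Finset α, G₂ ⊆ G₁ → Disjoint D W → F.pol W (G₁ ∪ D) (G₂ ∪ D) ≤ F.pol (W ∪ D) G₁ G₂ := by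
  induction D using Finset.induction_on with
  | empty =>
    intro W G₁ G₂ _ _
    rw [union_empty, union_empty, union_empty]
  | insert f D' hf ih =>
    intro W G₁ G₂ h hd
    have hfW : f ∉ W := Finset.disjoint_left.1 hd (mem_insert_self f D')
    have hd' : Disjoint D' W := Disjoint.mono_left (subset_insert f D') hd
    have hfWD : f ∉ W ∪ D' := by rw [mem_union, not_or]; exact ⟨hfW, hf⟩
    have step := F.pol_insert_offsets_le (W := W ∪ D') h hfWD
    have ih' := ih W (insert f G₁) (insert f G₂) (insert_subset_insert f h) hd'
    have e1 : G₁ ∪ insert f D' = insert f G₁ ∪ D' := by rw [union_insert, insert_union]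
    have e2 : G₂ ∪ insert f D' = insert f G₂ ∪ D' := by rw [union_insert, insert_union]
    have e3 : W ∪ insert f D' = insert f (W ∪ D') := union_insert f W D'
    rw [e1, e2, e3]
    exact le_trans ih' step

/-- Drop a whole set `D` (disjoint from the window). [this work] -/
theorem pol_drop_all (D : Finset α) :
    ∀ W G₁ G₂ : Finset α, G₂ ⊆ G₁ → Disjoint D W → F.pol W G₁ G₂ ≤ F.pol (W ∪ D) G₁ G₂ := by
  induction D using Finset.induction_on with
  | empty =>
    intro W G₁ G₂ _ _
    rw [union_empty]
  | insert f D' hf ih =>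
    intro W G₁ G₂ h hd
    have hfW : f ∉ W := Finset.disjoint_left.1 hd (mem_insert_self f D')
    have hd' : Disjoint D' W := Disjoint.mono_left (subset_insert f D') hd
    have hfWD : f ∉ W ∪ D' := by rw [mem_union, not_or]; exact ⟨hfW, hf⟩
    rw [union_insert]
    exact le_trans (ih W G₁ G₂ h hd') (F.pol_le_pol_insert h hfWD)

/-- **Every leaf is a lower bound**: for nested offsets and `Y ⊆ W`, `kkK (lab (G₁ ∪ Y)) (lab (G₂ ∪ Y)) ≤ pol W G₁ G₂`. [this work] -/
theorem kkK_leaf_le_pol {W G₁ G₂ : Finset α} (h : G₂ ⊆ G₁) {Y : Finset α} (hY : Y ⊆ W) :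
    kkK k (F.lab (G₁ ∪ Y)) (F.lab (G₂ ∪ Y)) ≤ F.pol W G₁ G₂ := by
  have h1 := F.pol_absorb_all Y ∅ G₁ G₂ h (disjoint_empty_right Y)
  rw [empty_union, F.pol_empty] at h1
  have h2 := F.pol_drop_all (W \ Y) Y G₁ G₂ h sdiff_disjoint
  rw [union_sdiff_of_subset hY] at h2
  exact le_trans h1 h2

/-- Window monotonicity for nested offsets: `W' ⊆ W → pol W' G₁ G₂ ≤ pol W G₁ G₂`. [this work] -/
theorem pol_mono_window {W W' G₁ G₂ : Finset α} (h : G₂ ⊆ G₁) (hW : W' ⊆ W) : F.pol W' G₁ G₂ ≤ F.pol W G₁ G₂ := by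
  have := F.pol_drop_all (W \ W') W' G₁ G₂ h sdiff_disjoint
  rwa [union_sdiff_of_subset hW] at this

/-! ## The slack of the full cube: complementation symmetry, the cover lemma and the configuration lemma -/

variable [Fintype α]

/-- The antipodal slack of the full cube, `Σ_S kkK (lab S) (lab Sᶜ)` (twice the `s(E)` of the memos). [this work] -/
def slackTop : ℤ := ∑ S : Finset α, kkK k (F.lab S) (F.lab Sᶜ)

/-- The complement of `S + v` is `(univ ∖ v) ∖ S`. [folklore] -/
theorem compl_insert_eq_erase_sdiff (v : α) (S : Finset α) :
    (insert v S)ᶜ = univ.erase v \ S := by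
  ext x
  simp only [mem_compl, mem_insert, not_or, mem_sdiff, mem_erase, mem_univ, and_true]

/-- For `S ⊆ univ ∖ v`, the complement of `S` is `((univ ∖ v) ∖ S) + v`. [folklore] -/
theorem compl_eq_insert_erase_sdiff {v : α} {S : Finset α} (hS : S ⊆ univ.erase v) :
    Sᶜ = insert v (univ.erase v \ S) := by
  have hv : v ∉ S := fun h => (notMem_erase v univ) (hS h)
  ext x
  simp only [mem_compl, mem_insert, mem_sdiff, mem_erase, mem_univ, and_true]
  constructor
  · intro hx
    by_cases hxv : x = v
    · exact Or.inl hxv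
    · exact Or.inr ⟨hxv, hx⟩
  · rintro (hxv | ⟨_, hx⟩)
    · rw [hxv]; exact hv
    · exact hx

/-- **Complementation symmetry**: `slackTop = 2 · pol (univ ∖ v) {v} ∅` for every `v`. [this work] -/
theorem slackTop_eq_two_mul_pol (v : α) : F.slackTop = 2 * F.pol (univ.erase v) {v} ∅ := by
  unfold slackTop pol
  have hv : v ∉ univ.erase v := notMem_erase v univ
  conv_lhs => rw [← Finset.powerset_univ, ← insert_erase (mem_univ v)]
  rw [sum_powerset_insert hv]
  have h1 : ∑ S ∈ (univ.erase v).powerset, kkK k (F.lab S) (F.lab Sᶜ)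
      = ∑ S ∈ (univ.erase v).powerset, kkK k (F.lab ({v} ∪ S)) (F.lab (∅ ∪ (univ.erase v \ S))) := by
    refine sum_nbij' (fun S => univ.erase v \ S) (fun S => univ.erase v \ S) ?_ ?_ ?_ ?_ ?_
    · intro S _; exact mem_powerset.2 sdiff_subset
    · intro S _; exact mem_powerset.2 sdiff_subset
    · intro S hS; exact Finset.sdiff_sdiff_eq_self (mem_powerset.1 hS)
    · intro S hS; exact Finset.sdiff_sdiff_eq_self (mem_powerset.1 hS)
    · intro S hS
      rw [compl_eq_insert_erase_sdiff (mem_powerset.1 hS), kkK_comm, empty_union,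
        Finset.sdiff_sdiff_eq_self (mem_powerset.1 hS), Finset.insert_eq]
  have h2 : ∑ S ∈ (univ.erase v).powerset, kkK k (F.lab (insert v S)) (F.lab (insert v S)ᶜ)
      = ∑ S ∈ (univ.erase v).powerset, kkK k (F.lab ({v} ∪ S)) (F.lab (∅ ∪ (univ.erase v \ S))) := by
    refine sum_congr rfl fun S hS => ?_
    rw [compl_insert_eq_erase_sdiff v S, empty_union, Finset.insert_eq]
  rw [h1, h2]
  ring

/-- `slackTop ≥ 0`. [this work] -/
theorem slackTop_nonneg [Nonempty α] : 0 ≤ F.slackTop := by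
  obtain ⟨v⟩ := ‹Nonempty α›
  rw [F.slackTop_eq_two_mul_pol v]
  have := F.pol_nonneg (univ.erase v) (empty_subset {v})
  linarith

/-- **COVER LEMMA**: a white set with a black upper cover forces strict antipodal Gladkov on the full cube: `slackTop ≥ 2`. [this work] -/
theorem two_le_slackTop_of_cover {Y : Finset α} {v : α} (hv : v ∉ Y) (hY : F.lab Y = 0)
    (hYv : F.lab (insert v Y) = Fin.last (k + 1)) : 2 ≤ F.slackTop := by
  rw [F.slackTop_eq_two_mul_pol v]
  have hYW : Y ⊆ univ.erase v := fun x hx => mem_erase.2 ⟨fun h => hv (h ▸ hx), mem_univ x⟩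
  have h := F.kkK_leaf_le_pol (W := univ.erase v) (empty_subset {v}) hYW
  rw [empty_union, ← Finset.insert_eq, hYv, hY, kkK_last_zero] at h
  linarith

/-- **CONFIGURATION LEMMA**: two sets `X ∋ v`, `Y ∌ v` and a coordinate `e ∉ X ∪ Y` whose configuration gap is positive force `slackTop ≥ 2`. [this work] -/
theorem two_le_slackTop_of_cgap_pos {X Y : Finset α} {v e : α} (hvX : v ∈ X) (hvY : v ∉ Y) (heX : e ∉ X) (heY : e ∉ Y)
    (hgap : 1 ≤ F.cgap X Y e) : 2 ≤ F.slackTop := by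
  -- decomposition of the configuration: C = X ∩ Y (common part), S = (X ∖ Y) ∖ v, T = Y ∖ X
  set C : Finset α := X ∩ Y with hC
  set S : Finset α := (X \ Y).erase v with hS
  set T : Finset α := Y \ X with hT
  have hve : v ≠ e := fun h => heX (h ▸ hvX)
  have hX : {v} ∪ C ∪ S = X := by
    ext x
    simp only [hC, hS, mem_union, mem_singleton, mem_inter, mem_erase, mem_sdiff]
    constructor
    · rintro ((hxv | ⟨hx, _⟩) | ⟨_, hx, _⟩)
      · rw [hxv]; exact hvX
      · exact hx
      · exact hx
    · intro hx
      by_cases hxv : x = v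
      · exact Or.inl (Or.inl hxv)
      · by_cases hxY : x ∈ Y
        · exact Or.inl (Or.inr ⟨hx, hxY⟩)
        · exact Or.inr ⟨hxv, hx, hxY⟩
  have hY : C ∪ T = Y := by
    ext x
    simp only [hC, hT, mem_union, mem_inter, mem_sdiff]
    constructor
    · rintro (⟨_, hx⟩ | ⟨hx, _⟩)
      · exact hx
      · exact hx
    · intro hx
      by_cases hxX : x ∈ X
      · exact Or.inl ⟨hxX, hx⟩
      · exact Or.inr ⟨hx, hxX⟩
  have hST : Disjoint S T := by
    rw [Finset.disjoint_left]
    intro x hxS hxT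
    rw [hS, mem_erase, mem_sdiff] at hxS
    rw [hT, mem_sdiff] at hxT
    exact hxS.2.2 hxT.1
  have heST : e ∉ S ∪ T := by
    rw [mem_union, not_or, hS, mem_erase, mem_sdiff, hT, mem_sdiff]
    exact ⟨fun h => heX h.2.1, fun h => heY h.1⟩
  have hTS : (S ∪ T) \ S = T := union_sdiff_cancel_left hST
  have hCdisj : Disjoint C (insert e (S ∪ T)) := by
    rw [Finset.disjoint_left]
    intro x hxC hx
    rw [hC, mem_inter] at hxC
    rcases mem_insert.1 hx with hxe | hx
    · exact heX (hxe ▸ hxC.1)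
    · rcases mem_union.1 hx with hx | hx
      · rw [hS, mem_erase, mem_sdiff] at hx; exact hx.2.2 hxC.2
      · rw [hT, mem_sdiff] at hx; exact hx.2 hxC.1
  have hWin : insert e (S ∪ T) ∪ C ⊆ univ.erase v := by
    intro x hx
    rw [mem_erase]
    refine ⟨?_, mem_univ x⟩
    intro hxv
    rw [hxv] at hx
    rcases mem_union.1 hx with hx | hx
    · rcases mem_insert.1 hx with hxe | hx
      · exact hve hxe
      · rcases mem_union.1 hx with hx | hx
        · rw [hS] at hx; exact (notMem_erase v _) hx
        · rw [hT, mem_sdiff] at hx; exact hvY hx.1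
    · rw [hC, mem_inter] at hx; exact hvY hx.2
  -- chain of lower bounds: window monotonicity, absorb C, keep the gap of (S; e)
  rw [F.slackTop_eq_two_mul_pol v]
  have hsub : (∅ : Finset α) ⊆ {v} := empty_subset {v}
  have hsub' : ∅ ∪ C ⊆ {v} ∪ C := union_subset_union hsub (subset_refl C)
  have h1 := F.pol_mono_window hsub hWin
  have h2 := F.pol_absorb_all C (insert e (S ∪ T)) {v} ∅ hsub hCdisj
  have h3 := F.pol_insert_ge_gap ({v} ∪ C) (∅ ∪ C) heST subset_union_left
  have h4 := F.pol_nonneg (S ∪ T) hsub'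
  have h5 := F.pol_nonneg (S ∪ T) (insert_subset_insert e hsub')
  have hgap' : F.cgap ({v} ∪ C ∪ S) (∅ ∪ C ∪ ((S ∪ T) \ S)) e = F.cgap X Y e := by
    rw [hTS, empty_union, hX, hY]
  rw [hgap'] at h3
  linarith


/-! ## Link with the slot form `ZK = 3·SwK [decided] − NtriK` of p339016 -/

/-- The decided-spectator sum dominates its `K = ∅` term: if `∅` is white then `slackTop ≤ SwK (decK k)`. [this work] -/
theorem slackTop_le_SwK_decK (h0 : F.lab ∅ = 0) : F.slackTop ≤ F.SwK (decK k) := by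
  unfold SwK slackTop
  rw [Sunflower.sum_parts_eq (f := fun S T => decK k (F.lab S) * kkK k (F.lab T) (F.lab (S ∪ T)ᶜ))]
  have hterm : ∀ S ∈ (univ : Finset (Finset α)),
      0 ≤ ∑ T ∈ (Sᶜ).powerset, decK k (F.lab S) * kkK k (F.lab T) (F.lab (S ∪ T)ᶜ) := by
    intro S _
    rw [← mul_sum]
    refine mul_nonneg (by unfold decK; split_ifs <;> norm_num) ?_
    have h := F.antipodal_gladkov Sᶜ
    refine le_of_le_of_eq h (sum_congr rfl fun T _ => ?_)
    rw [compl_union, sdiff_eq_inter_compl, inter_comm]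
  have hdec : decK k (F.lab ∅) = 1 := by rw [h0]; unfold decK; simp
  have h0term : ∑ T ∈ ((∅ : Finset α)ᶜ).powerset, decK k (F.lab ∅) * kkK k (F.lab T) (F.lab (∅ ∪ T)ᶜ)
      = ∑ S : Finset α, kkK k (F.lab S) (F.lab Sᶜ) := by
    rw [hdec, compl_empty, Finset.powerset_univ]
    refine sum_congr rfl fun T _ => ?_
    rw [one_mul, empty_union]
  rw [← h0term]
  exact single_le_sum hterm (mem_univ ∅)

/-- **★ₖ when the rainbows fit into the slack of the top cube**: `∅` white and `NtriK ≤ 3·slackTop` (i.e. `#rainbows ≤ s(E)`) give `0 ≤ ZK`.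
(By the census of the memo this covers all but 1 320 of the 178 060 five-point structures with rainbows; it is where the cover and configuration
lemmas feed lower bounds for `slackTop` into the slot form.) [this work] -/
theorem ZK_nonneg_of_NtriK_le_slackTop (h0 : F.lab ∅ = 0) (h : F.NtriK ≤ 3 * F.slackTop) : 0 ≤ F.ZK := by
  rw [F.ZK_eq_spec]
  have := F.slackTop_le_SwK_decK h0
  linarith

end MSunflower

end Summit.CriticalPhenomena.PercolationContinuityZ3.Theorems.SunflowerPartition
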